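import Literature.Geometry.Lorentzian.CoordCurvatureEvolution
import Literature.Geometry.Lorentzian.CoordCurvatureNormSq
import HarnessLib

/-!
# Evolution of `|Rm|²` under the Ricci flow, in coordinates (Topping 2006, Prop. 3.2.10)

For a smooth one-parameter family of metric components `G : ℝ → E → (E →L E →L ℝ)` on `V × S`
(`IsMetricFamilyOn G S V`) solving the Ricci flow in coordinates `∂G/∂t = −2 Ric(G)`, the square
norm of the curvature tensor `u = |Rm|²_G = rmNormSqAt (G t)` (`CoordCurvatureNormSq.lean`)
satisfies, at every point where `G t x` is positive definite,

  `∂_t u ≤ Δ u + C(n) u √u`   (`IsMetricFamilyOn.derivWithin_rmNormSqAt_le`),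

`Δ = lapAt (G t)` the coordinate Laplace–Beltrami operator (`CoordScalarCurvatureEvolution.lean`)
and `C(n) = rmEvolutionConst n` an explicit polynomial in `n = dim E`. This is **Topping 2006,
Prop. 3.2.10** in its weakened form `∂_t|Rm|² ≤ Δ|Rm|² + C|Rm|³` ((3.2.4) with the good term
`−2|∇Rm|²` dropped, p. 37), the input of the maximum-principle argument of Thm. 3.2.11. The proof
is the printed computation:

* `IsMetricOn.fderiv_sum_ginv_ginv_mul` — double metric contractions commute with `∇`
  (`fderiv_sum_ginv_smul` twice);
* `IsMetricOn.fderiv_rmNormSqAt` — `d|Rm|² (W) = 2⟨∇_W Rm, Rm⟩`, here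
  `∂_W u = −Σ g g [tr((∇_W R)(a,c) R(a',c')) + tr(R(a,c) (∇_W R)(a',c'))]`;
* `IsMetricOn.hessAt_rmNormSqAt`, `IsMetricOn.lapAt_rmNormSqAt` —
  `Δ|Rm|² = 2⟨ΔRm, Rm⟩ + 2|∇Rm|²`, here `Δu = −2 Σ gg tr((ΔR)(a,c)R(a',c')) − 2 Σ g^{kl} gg
  tr((∇_k R)(a,c)(∇_l R)(a',c'))` with `ΔR = lapRiemAt`;
* `IsMetricFamilyOn.hasDerivWithinAt_rmNormSqAt` — `∂_t |Rm|² = 2⟨∂_t Rm, Rm⟩ + (∂_t g⁻¹) * Rm * Rm`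
  with `∂_t Rm = ΔRm + Rm * Rm` (Prop. 2.5.1, `apply_varRiemAt_of_flow`);
* in a `G_t(x)`-orthonormal basis: `−Σ g^{kl} gg tr((∇_kR)(∇_lR)) = −|∇Rm|² ≤ 0`, every cubic
  term is at most a multiple of `|Rm|³` (component bounds of `CoordCurvatureNormSq.lean`).

Everything is proved; the only definition is the constant `rmEvolutionConst`.

## References

* P. Topping, *Lectures on the Ricci flow*, LMS Lecture Note Series 325, CUP 2006, §3.2,
  Prop. 3.2.10 and its proof, (3.2.4), p. 37; Prop. 2.5.1, Remark 2.5.2. [Topping2006]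
* R. S. Hamilton, *Three-manifolds with positive Ricci curvature*, J. Differential Geom. 17
  (1982), §13, Cor. 13.3 ff. (`|Rm|²` evolution). [Hamilton1982]
-/

noncomputable section

set_option maxSynthPendingDepth 3

open Set Filter ContinuousLinearMap Module
open scoped Topology ContDiff

namespace Literature.Geometry.Lorentzian

namespace MetricCoord

variable {E : Type*} [NormedAddCommGroup E] [NormedSpace ℝ E]

/-! ### Linearity of `∇R` in its slots; the derivative of `R` and of `∇R` through `∇R`, `∇²R` -/

section Linear

variable [CompleteSpace E] {G : E → E →L[ℝ] E →L[ℝ] ℝ} {V : Set E} {x : E}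

/-- `(∇_W R)(Y, V)` is additive in `Y` (on `V`). [folklore] -/
theorem IsMetricOn.covRiemAt_add_mid (hG : IsMetricOn G V) (hx : x ∈ V) (W Y₁ Y₂ Z : E) :
    covRiemAt G x W (Y₁ + Y₂) Z = covRiemAt G x W Y₁ Z + covRiemAt G x W Y₂ Z := by
  simp only [hG.covRiemAt_eq_riemCLM hx, map_add, _root_.add_apply, ContinuousLinearMap.comp_add,
    ContinuousLinearMap.add_comp]
  abel

/-- `(∇_W R)(Y, V)` is homogeneous in `Y` (on `V`). [folklore] -/
theorem IsMetricOn.covRiemAt_smul_mid (hG : IsMetricOn G V) (hx : x ∈ V) (c : ℝ) (W Y Z : E) :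
    covRiemAt G x W (c • Y) Z = c • covRiemAt G x W Y Z := by
  simp only [hG.covRiemAt_eq_riemCLM hx, map_smul, _root_.smul_apply, ContinuousLinearMap.comp_smul,
    ContinuousLinearMap.smul_comp, smul_sub, smul_add]

/-- `(∇_W R)(Y, V)` is additive in `V` (on `V`). [folklore] -/
theorem IsMetricOn.covRiemAt_add_right (hG : IsMetricOn G V) (hx : x ∈ V) (W Y Z₁ Z₂ : E) :
    covRiemAt G x W Y (Z₁ + Z₂) = covRiemAt G x W Y Z₁ + covRiemAt G x W Y Z₂ := by
  simp only [hG.covRiemAt_eq_riemCLM hx, map_add, ContinuousLinearMap.comp_add,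
    ContinuousLinearMap.add_comp]
  abel

/-- `(∇_W R)(Y, V)` is homogeneous in `V` (on `V`). [folklore] -/
theorem IsMetricOn.covRiemAt_smul_right (hG : IsMetricOn G V) (hx : x ∈ V) (c : ℝ) (W Y Z : E) :
    covRiemAt G x W Y (c • Z) = c • covRiemAt G x W Y Z := by
  simp only [hG.covRiemAt_eq_riemCLM hx, map_smul, ContinuousLinearMap.comp_smul,
    ContinuousLinearMap.smul_comp, smul_sub, smul_add]

omit [CompleteSpace E] in
/-- **`∂_W R` through `∇_W R`**: `∂_W R(A,C) = (∇_W R)(A,C) − Γ_W R + R Γ_W + R(Γ(W,A),C) + R(A,Γ(W,C))`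
(the definition of `covRiemAt`, rearranged). [cite: ONeill1983, Ch. 3, Prop. 3.37] -/
theorem fderiv_riemAt_eq_covRiemAt (W A C : E) :
    fderiv ℝ (fun y ↦ riemAt G y A C) x W = covRiemAt G x W A C
      - (chrAt G x W).comp (riemAt G x A C) + (riemAt G x A C).comp (chrAt G x W)
      + riemAt G x (chrAt G x W A) C + riemAt G x A (chrAt G x W C) := by
  simp only [covRiemAt]
  abel

omit [CompleteSpace E] in
/-- **`∂_Y ∇_Z R` through `∇²R`**:
`∂_Y (∇_Z R)(A,C) = (∇²_{Y,Z}R)(A,C) − Γ_Y (∇_ZR)(A,C) + (∇_ZR)(A,C) Γ_Y + (∇_{Γ(Y,Z)}R)(A,C)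
  + (∇_ZR)(Γ(Y,A),C) + (∇_ZR)(A,Γ(Y,C))` (the definition of `cov2RiemAt`, rearranged).
[cite: Topping2006, §2.1] -/
theorem fderiv_covRiemAt_eq_cov2RiemAt (Y Z A C : E) :
    fderiv ℝ (fun y ↦ covRiemAt G y Z A C) x Y = cov2RiemAt G x Y Z A C
      - (chrAt G x Y).comp (covRiemAt G x Z A C) + (covRiemAt G x Z A C).comp (chrAt G x Y)
      + covRiemAt G x (chrAt G x Y Z) A C + covRiemAt G x Z (chrAt G x Y A) C
      + covRiemAt G x Z A (chrAt G x Y C) := by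
  rw [cov2RiemAt_def]
  abel

omit [CompleteSpace E] in
/-- The conjugation terms cancel under the trace:
`−tr((Γ A) B) + tr((A Γ) B) − tr(A (Γ B)) + tr(A (B Γ)) = 0`. [folklore] -/
theorem traceCLM_conj_cancel [FiniteDimensional ℝ E] (Γ A B : E →L[ℝ] E) :
    -traceCLM E (((Γ.comp A).comp B)) + traceCLM E ((A.comp Γ).comp B)
      - traceCLM E (A.comp (Γ.comp B)) + traceCLM E (A.comp (B.comp Γ)) = 0 := by
  rw [ContinuousLinearMap.comp_assoc, ContinuousLinearMap.comp_assoc,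
    ← ContinuousLinearMap.comp_assoc A B Γ, traceCLM_comp_comm (A.comp B) Γ]
  abel

end Linear

/-! ### Double metric contractions commute with covariant differentiation -/

section Contr₄

variable {ι : Type*} [Fintype ι] [FiniteDimensional ℝ E] [CompleteSpace E]
  {G : E → E →L[ℝ] E →L[ℝ] ℝ} {V : Set E} {x : E} (b : Basis ι ℝ E)

/-- **Double contractions commute with `∇`**: for a field `T_y(A,A',C,C')` whose components are
differentiable at `x`, with `Q₁(A,A') = Σ g^{cc'} T_x(A,A',b_c,b_{c'})` and
`Q₂(C,C') = Σ g^{aa'} T_x(b_a,b_{a'},C,C')` bilinear,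
`∂_W Σ g^{aa'}g^{cc'} T(b_a,b_{a'},b_c,b_{c'}) = Σ g^{aa'}g^{cc'} ∂_W T(b_a,b_{a'},b_c,b_{c'})
  − Σ g^{aa'}[Q₁(Γ(W,b_a),b_{a'}) + Q₁(b_a,Γ(W,b_{a'}))] − Σ g^{cc'}[Q₂(Γ(W,b_c),b_{c'}) + Q₂(b_c,Γ(W,b_{c'}))]`
(`sum_fderiv_ginv_smul` in each pair of slots). [cite: ONeill1983, Ch. 3, p. 86] -/
theorem IsMetricOn.fderiv_sum_ginv_ginv_mul (hG : IsMetricOn G V) (hx : x ∈ V)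
    {T : E → E → E → E → E → ℝ}
    (hT : ∀ a a' c c', DifferentiableAt ℝ (fun y ↦ T y (b a) (b a') (b c) (b c')) x)
    (Q₁ : E →ₗ[ℝ] E →ₗ[ℝ] ℝ) (hQ₁ : ∀ A A', Q₁ A A' = ∑ c, ∑ c', ginv G b x c c' * T x A A' (b c) (b c'))
    (Q₂ : E →ₗ[ℝ] E →ₗ[ℝ] ℝ) (hQ₂ : ∀ C C', Q₂ C C' = ∑ a, ∑ a', ginv G b x a a' * T x (b a) (b a') C C')
    (W : E) :
    fderiv ℝ (fun y ↦ ∑ a, ∑ a', ∑ c, ∑ c', ginv G b y a a' * ginv G b y c c' *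
        T y (b a) (b a') (b c) (b c')) x W =
      ∑ a, ∑ a', ∑ c, ∑ c', ginv G b x a a' * ginv G b x c c' *
          fderiv ℝ (fun y ↦ T y (b a) (b a') (b c) (b c')) x W
        - ∑ a, ∑ a', ginv G b x a a' * (Q₁ (chrAt G x W (b a)) (b a') + Q₁ (b a) (chrAt G x W (b a')))
        - ∑ c, ∑ c', ginv G b x c c' * (Q₂ (chrAt G x W (b c)) (b c') + Q₂ (b c) (chrAt G x W (b c'))) := by
  have hg : ∀ k l, DifferentiableAt ℝ (fun y ↦ ginv G b y k l) x := fun k l ↦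
    ((hG.contDiffOn_ginv b k l x hx).contDiffAt (hG.mem_nhds hx)).differentiableAt (by simp)
  set g := ginv G b x with hgdef
  set dg : ι → ι → ℝ := fun k l ↦ fderiv ℝ (fun y ↦ ginv G b y k l) x W with hdg
  set dT : ι → ι → ι → ι → ℝ := fun a a' c c' ↦
    fderiv ℝ (fun y ↦ T y (b a) (b a') (b c) (b c')) x W with hdT
  -- the derivative of each term
  have hterm : ∀ a a' c c', fderiv ℝ (fun y ↦ ginv G b y a a' * ginv G b y c c' *
      T y (b a) (b a') (b c) (b c')) x W =
      dg a a' * g c c' * T x (b a) (b a') (b c) (b c') + g a a' * dg c c' * T x (b a) (b a') (b c) (b c')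
        + g a a' * g c c' * dT a a' c c' := by
    intro a a' c c'
    rw [fderiv_fun_mul ((hg a a').fun_mul (hg c c')) (hT a a' c c'), fderiv_fun_mul (hg a a') (hg c c')]
    simp only [_root_.add_apply, _root_.smul_apply, smul_eq_mul, hgdef, hdg, hdT]
    ring
  rw [fderiv_fun_sum fun a _ ↦ ?_]
  swap
  · exact DifferentiableAt.fun_sum fun a' _ ↦ DifferentiableAt.fun_sum fun c _ ↦
      DifferentiableAt.fun_sum fun c' _ ↦ ((hg a a').fun_mul (hg c c')).fun_mul (hT a a' c c')
  simp only [_root_.sum_apply]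
  have hinner : ∀ a, fderiv ℝ (fun y ↦ ∑ a', ∑ c, ∑ c', ginv G b y a a' * ginv G b y c c' *
      T y (b a) (b a') (b c) (b c')) x W = ∑ a', ∑ c, ∑ c',
      (dg a a' * g c c' * T x (b a) (b a') (b c) (b c') + g a a' * dg c c' * T x (b a) (b a') (b c) (b c')
        + g a a' * g c c' * dT a a' c c') := by
    intro a
    rw [fderiv_fun_sum fun a' _ ↦ ?_]
    swap
    · exact DifferentiableAt.fun_sum fun c _ ↦
        DifferentiableAt.fun_sum fun c' _ ↦ ((hg a a').fun_mul (hg c c')).fun_mul (hT a a' c c')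
    simp only [_root_.sum_apply]
    refine Finset.sum_congr rfl fun a' _ ↦ ?_
    rw [fderiv_fun_sum fun c _ ↦ ?_]
    swap
    · exact DifferentiableAt.fun_sum fun c' _ ↦ ((hg a a').fun_mul (hg c c')).fun_mul (hT a a' c c')
    simp only [_root_.sum_apply]
    refine Finset.sum_congr rfl fun c _ ↦ ?_
    rw [fderiv_fun_sum fun c' _ ↦ ?_]
    swap
    · exact ((hg a a').fun_mul (hg c c')).fun_mul (hT a a' c c')
    simp only [_root_.sum_apply]
    exact Finset.sum_congr rfl fun c' _ ↦ hterm a a' c c'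
  simp only [hinner, Finset.sum_add_distrib]
  -- the two groups of `∂g` terms
  have h1 : ∑ a, ∑ a', ∑ c, ∑ c', dg a a' * g c c' * T x (b a) (b a') (b c) (b c') =
      -∑ a, ∑ a', g a a' * (Q₁ (chrAt G x W (b a)) (b a') + Q₁ (b a) (chrAt G x W (b a'))) := by
    have key := hG.sum_fderiv_ginv_smul b hx Q₁ W
    simp only [smul_eq_mul] at key
    rw [← key]
    refine Finset.sum_congr rfl fun a _ ↦ Finset.sum_congr rfl fun a' _ ↦ ?_
    rw [hQ₁, Finset.mul_sum]
    refine Finset.sum_congr rfl fun c _ ↦ ?_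
    rw [Finset.mul_sum]
    exact Finset.sum_congr rfl fun c' _ ↦ by simp only [hdg, hgdef]; ring
  have h2 : ∑ a, ∑ a', ∑ c, ∑ c', g a a' * dg c c' * T x (b a) (b a') (b c) (b c') =
      -∑ c, ∑ c', g c c' * (Q₂ (chrAt G x W (b c)) (b c') + Q₂ (b c) (chrAt G x W (b c'))) := by
    have key := hG.sum_fderiv_ginv_smul b hx Q₂ W
    simp only [smul_eq_mul] at key
    rw [sum_comm_pairs, ← key]
    refine Finset.sum_congr rfl fun c _ ↦ Finset.sum_congr rfl fun c' _ ↦ ?_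
    rw [hQ₂, Finset.mul_sum]
    refine Finset.sum_congr rfl fun a _ ↦ ?_
    rw [Finset.mul_sum]
    exact Finset.sum_congr rfl fun a' _ ↦ by simp only [hdg, hgdef]; ring
  rw [h1, h2]
  simp only [hgdef, hdT]
  ring

end Contr₄

/-! ### The differential of `|Rm|²`: `d|Rm|²(W) = 2⟨∇_W Rm, Rm⟩` -/

section FirstDerivative

variable {ι : Type*} [Fintype ι] [FiniteDimensional ℝ E] [CompleteSpace E]
  {G : E → E →L[ℝ] E →L[ℝ] ℝ} {V : Set E} {x : E} (b : Basis ι ℝ E)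

omit [CompleteSpace E] in
/-- **The derivative of a trace pairing**: for differentiable `A, B : E → End E`,
`∂_W tr(A B) = tr(∂_W A B) + tr(A ∂_W B)`. [folklore] -/
theorem fderiv_traceCLM_comp {A B : E → E →L[ℝ] E} (hA : DifferentiableAt ℝ A x)
    (hB : DifferentiableAt ℝ B x) (W : E) :
    fderiv ℝ (fun y ↦ traceCLM E ((A y).comp (B y))) x W =
      traceCLM E ((fderiv ℝ A x W).comp (B x)) + traceCLM E ((A x).comp (fderiv ℝ B x W)) := by
  have hc := (traceCLM E).hasFDerivAt.comp x (hA.hasFDerivAt.clm_comp hB.hasFDerivAt)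
  rw [show (fun y ↦ traceCLM E ((A y).comp (B y))) = (traceCLM E) ∘ (fun y ↦ (A y).comp (B y))
    from rfl, hc.fderiv]
  simp only [ContinuousLinearMap.comp_apply, _root_.add_apply, ContinuousLinearMap.compL_apply,
    flip_apply, map_add]
  ring

/-- **The derivative of the trace pairing of curvature endomorphisms**:
`∂_W tr(R(A,C) R(A',C')) = tr(∂_W R(A,C) R(A',C')) + tr(R(A,C) ∂_W R(A',C'))`. [folklore] -/
theorem IsMetricOn.fderiv_traceCLM_riemAt_comp (hG : IsMetricOn G V) (hx : x ∈ V) (A C A' C' W : E) :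
    fderiv ℝ (fun y ↦ traceCLM E ((riemAt G y A C).comp (riemAt G y A' C'))) x W =
      traceCLM E ((fderiv ℝ (fun y ↦ riemAt G y A C) x W).comp (riemAt G x A' C'))
        + traceCLM E ((riemAt G x A C).comp (fderiv ℝ (fun y ↦ riemAt G y A' C') x W)) :=
  fderiv_traceCLM_comp (hG.differentiableAt_riemAt hx A C) (hG.differentiableAt_riemAt hx A' C') W

/-- **The differential of `|Rm|²`** (Topping 2006, proof of Prop. 3.2.10: `d|Rm|² = 2⟨Rm, ∇Rm⟩`),
in coordinates: `∂_W |Rm|²_G = −Σ g^{aa'}g^{cc'} [tr((∇_W R)(b_a,b_c) R(b_{a'},b_{c'}))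
  + tr(R(b_a,b_c) (∇_W R)(b_{a'},b_{c'}))]`. [cite: Topping2006, Prop. 3.2.10 (proof)] -/
theorem IsMetricOn.fderiv_rmNormSqAt (hG : IsMetricOn G V) (hx : x ∈ V) (W : E) :
    fderiv ℝ (rmNormSqAt G) x W = -∑ a, ∑ a', ∑ c, ∑ c', ginv G b x a a' * ginv G b x c c' *
      (traceCLM E ((covRiemAt G x W (b a) (b c)).comp (riemAt G x (b a') (b c')))
        + traceCLM E ((riemAt G x (b a) (b c)).comp (covRiemAt G x W (b a') (b c')))) := by
  -- the components and the two partial contractions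
  set T : E → E → E → E → E → ℝ := fun y A A' C C' ↦
    traceCLM E ((riemAt G y A C).comp (riemAt G y A' C')) with hTdef
  have hT : ∀ a a' c c', DifferentiableAt ℝ (fun y ↦ T y (b a) (b a') (b c) (b c')) x := fun a a' c c' ↦
    ((traceCLM E).differentiableAt).comp x
      ((hG.differentiableAt_riemAt hx (b a) (b c)).clm_comp (hG.differentiableAt_riemAt hx (b a') (b c')))
  set Q₁ : E →ₗ[ℝ] E →ₗ[ℝ] ℝ := LinearMap.mk₂ ℝ
    (fun A A' ↦ ∑ c, ∑ c', ginv G b x c c' * T x A A' (b c) (b c'))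
    (fun A₁ A₂ A' ↦ by
      simp only [hTdef, riemAt_add_left, ContinuousLinearMap.add_comp, map_add, mul_add,
        Finset.sum_add_distrib])
    (fun r A A' ↦ by
      simp only [hTdef, riemAt_smul_left, ContinuousLinearMap.smul_comp, map_smul, smul_eq_mul,
        Finset.mul_sum]
      exact Finset.sum_congr rfl fun _ _ ↦ Finset.sum_congr rfl fun _ _ ↦ by ring)
    (fun A A₁ A₂ ↦ by
      simp only [hTdef, riemAt_add_left, ContinuousLinearMap.comp_add, map_add, mul_add,
        Finset.sum_add_distrib])
    (fun r A A' ↦ by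
      simp only [hTdef, riemAt_smul_left, ContinuousLinearMap.comp_smul, map_smul, smul_eq_mul,
        Finset.mul_sum]
      exact Finset.sum_congr rfl fun _ _ ↦ Finset.sum_congr rfl fun _ _ ↦ by ring) with hQ₁def
  set Q₂ : E →ₗ[ℝ] E →ₗ[ℝ] ℝ := LinearMap.mk₂ ℝ
    (fun C C' ↦ ∑ a, ∑ a', ginv G b x a a' * T x (b a) (b a') C C')
    (fun C₁ C₂ C' ↦ by
      simp only [hTdef, riemAt_add_right, ContinuousLinearMap.add_comp, map_add, mul_add,
        Finset.sum_add_distrib])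
    (fun r C C' ↦ by
      simp only [hTdef, riemAt_smul_right, ContinuousLinearMap.smul_comp, map_smul, smul_eq_mul,
        Finset.mul_sum]
      exact Finset.sum_congr rfl fun _ _ ↦ Finset.sum_congr rfl fun _ _ ↦ by ring)
    (fun C C₁ C₂ ↦ by
      simp only [hTdef, riemAt_add_right, ContinuousLinearMap.comp_add, map_add, mul_add,
        Finset.sum_add_distrib])
    (fun r C C' ↦ by
      simp only [hTdef, riemAt_smul_right, ContinuousLinearMap.comp_smul, map_smul, smul_eq_mul,
        Finset.mul_sum]
      exact Finset.sum_congr rfl fun _ _ ↦ Finset.sum_congr rfl fun _ _ ↦ by ring) with hQ₂def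
  have hQ₁ : ∀ A A', Q₁ A A' = ∑ c, ∑ c', ginv G b x c c' * T x A A' (b c) (b c') := fun _ _ ↦ rfl
  have hQ₂ : ∀ C C', Q₂ C C' = ∑ a, ∑ a', ginv G b x a a' * T x (b a) (b a') C C' := fun _ _ ↦ rfl
  have heq : rmNormSqAt G = fun y ↦ -∑ a, ∑ a', ∑ c, ∑ c', ginv G b y a a' * ginv G b y c c' *
      T y (b a) (b a') (b c) (b c') := funext fun y ↦ rmNormSqAt_eq_sum b
  rw [heq, fderiv_fun_neg, _root_.neg_apply, hG.fderiv_sum_ginv_ginv_mul b hx hT Q₁ hQ₁ Q₂ hQ₂ W]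
  -- the derivative of the components
  set g := ginv G b x with hgdef
  set Γ := chrAt G x W with hΓ
  have hdT : ∀ a a' c c', fderiv ℝ (fun y ↦ T y (b a) (b a') (b c) (b c')) x W =
      traceCLM E ((covRiemAt G x W (b a) (b c)).comp (riemAt G x (b a') (b c')))
        + traceCLM E ((riemAt G x (b a) (b c)).comp (covRiemAt G x W (b a') (b c')))
        + (T x (Γ (b a)) (b a') (b c) (b c') + T x (b a) (Γ (b a')) (b c) (b c'))
        + (T x (b a) (b a') (Γ (b c)) (b c') + T x (b a) (b a') (b c) (Γ (b c'))) := by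
    intro a a' c c'
    simp only [hTdef]
    rw [hG.fderiv_traceCLM_riemAt_comp hx, fderiv_riemAt_eq_covRiemAt, fderiv_riemAt_eq_covRiemAt]
    simp only [ContinuousLinearMap.add_comp, ContinuousLinearMap.sub_comp,
      ContinuousLinearMap.comp_add, ContinuousLinearMap.comp_sub, map_add, map_sub, hΓ]
    have hc := traceCLM_conj_cancel (chrAt G x W) (riemAt G x (b a) (b c)) (riemAt G x (b a') (b c'))
    linear_combination hc
  -- regroup the correction terms
  have hR1 : ∑ a, ∑ a', ∑ c, ∑ c', g a a' * g c c' *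
      (T x (Γ (b a)) (b a') (b c) (b c') + T x (b a) (Γ (b a')) (b c) (b c')) =
      ∑ a, ∑ a', g a a' * (Q₁ (Γ (b a)) (b a') + Q₁ (b a) (Γ (b a'))) := by
    refine Finset.sum_congr rfl fun a _ ↦ Finset.sum_congr rfl fun a' _ ↦ ?_
    rw [hQ₁, hQ₁, mul_add, Finset.mul_sum, Finset.mul_sum, ← Finset.sum_add_distrib]
    refine Finset.sum_congr rfl fun c _ ↦ ?_
    rw [Finset.mul_sum, Finset.mul_sum, ← Finset.sum_add_distrib]
    exact Finset.sum_congr rfl fun c' _ ↦ by ring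
  have hR2 : ∑ a, ∑ a', ∑ c, ∑ c', g a a' * g c c' *
      (T x (b a) (b a') (Γ (b c)) (b c') + T x (b a) (b a') (b c) (Γ (b c'))) =
      ∑ c, ∑ c', g c c' * (Q₂ (Γ (b c)) (b c') + Q₂ (b c) (Γ (b c'))) := by
    rw [sum_comm_pairs]
    refine Finset.sum_congr rfl fun c _ ↦ Finset.sum_congr rfl fun c' _ ↦ ?_
    rw [hQ₂, hQ₂, mul_add, Finset.mul_sum, Finset.mul_sum, ← Finset.sum_add_distrib]
    refine Finset.sum_congr rfl fun a _ ↦ ?_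
    rw [Finset.mul_sum, Finset.mul_sum, ← Finset.sum_add_distrib]
    exact Finset.sum_congr rfl fun a' _ ↦ by ring
  simp only [hdT, mul_add, Finset.sum_add_distrib] at hR1 hR2 ⊢
  linarith

/-- `|Rm|²_G` is differentiable at the points of `V`. [folklore] -/
theorem IsMetricOn.differentiableAt_rmNormSqAt (hG : IsMetricOn G V) (hx : x ∈ V) :
    DifferentiableAt ℝ (rmNormSqAt G) x :=
  ((hG.contDiffOn_rmNormSqAt x hx).contDiffAt (hG.mem_nhds hx)).differentiableAt (by simp)

/-- `|Rm|²_G` is `C^∞` at the points of `V`. [folklore] -/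
theorem IsMetricOn.contDiffAt_rmNormSqAt (hG : IsMetricOn G V) (hx : x ∈ V) :
    ContDiffAt ℝ ∞ (rmNormSqAt G) x :=
  (hG.contDiffOn_rmNormSqAt x hx).contDiffAt (hG.mem_nhds hx)

end FirstDerivative

/-! ### The Hessian and the Laplacian of `|Rm|²`: `Δ|Rm|² = 2⟨ΔRm, Rm⟩ + 2|∇Rm|²` -/

section SecondDerivative

variable {ι : Type*} [Fintype ι] [FiniteDimensional ℝ E] [CompleteSpace E]
  {G : E → E →L[ℝ] E →L[ℝ] ℝ} {V : Set E} {x : E} (b : Basis ι ℝ E)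

omit [FiniteDimensional ℝ E] [CompleteSpace E] in
/-- Relabelling a double contraction using the symmetry of `g⁻¹`:
`Σ g^{aa'}g^{cc'} f(a',a,c',c) = Σ g^{aa'}g^{cc'} f(a,a',c,c')`. [folklore] -/
theorem sum_ginv_ginv_swap {g : ι → ι → ℝ} (hg : ∀ i j, g i j = g j i) (f : ι → ι → ι → ι → ℝ) :
    ∑ a, ∑ a', ∑ c, ∑ c', g a a' * g c c' * f a' a c' c =
      ∑ a, ∑ a', ∑ c, ∑ c', g a a' * g c c' * f a a' c c' := by
  rw [Finset.sum_comm]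
  refine Finset.sum_congr rfl fun a _ ↦ Finset.sum_congr rfl fun a' _ ↦ ?_
  rw [Finset.sum_comm]
  refine Finset.sum_congr rfl fun c _ ↦ Finset.sum_congr rfl fun c' _ ↦ ?_
  rw [hg a' a, hg c' c]

omit [FiniteDimensional ℝ E] [CompleteSpace E] in
/-- Exchanging a fourfold and a double sum:
`Σ_{aa'cc'} w Σ_{kl} v t = Σ_{kl} v Σ_{aa'cc'} w t`. [folklore] -/
theorem sum₄_mul_sum₂ (w : ι → ι → ι → ι → ℝ) (v : ι → ι → ℝ) (t : ι → ι → ι → ι → ι → ι → ℝ) :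
    ∑ a, ∑ a', ∑ c, ∑ c', w a a' c c' * ∑ k, ∑ l, v k l * t k l a a' c c' =
      ∑ k, ∑ l, v k l * ∑ a, ∑ a', ∑ c, ∑ c', w a a' c c' * t k l a a' c c' := by
  simp only [Finset.mul_sum]
  -- move `k` to the front
  have e1 : ∑ a, ∑ a', ∑ c, ∑ c', ∑ k, ∑ l, w a a' c c' * (v k l * t k l a a' c c') =
      ∑ k, ∑ a, ∑ a', ∑ c, ∑ c', ∑ l, w a a' c c' * (v k l * t k l a a' c c') := by
    calc ∑ a, ∑ a', ∑ c, ∑ c', ∑ k, ∑ l, w a a' c c' * (v k l * t k l a a' c c')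
        = ∑ a, ∑ a', ∑ c, ∑ k, ∑ c', ∑ l, w a a' c c' * (v k l * t k l a a' c c') :=
          Finset.sum_congr rfl fun a _ ↦ Finset.sum_congr rfl fun a' _ ↦
            Finset.sum_congr rfl fun c _ ↦ Finset.sum_comm
      _ = ∑ a, ∑ a', ∑ k, ∑ c, ∑ c', ∑ l, w a a' c c' * (v k l * t k l a a' c c') :=
          Finset.sum_congr rfl fun a _ ↦ Finset.sum_congr rfl fun a' _ ↦ Finset.sum_comm
      _ = ∑ a, ∑ k, ∑ a', ∑ c, ∑ c', ∑ l, w a a' c c' * (v k l * t k l a a' c c') :=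
          Finset.sum_congr rfl fun a _ ↦ Finset.sum_comm
      _ = ∑ k, ∑ a, ∑ a', ∑ c, ∑ c', ∑ l, w a a' c c' * (v k l * t k l a a' c c') := Finset.sum_comm
  -- move `l` to the second place
  have e2 : ∀ k, ∑ a, ∑ a', ∑ c, ∑ c', ∑ l, w a a' c c' * (v k l * t k l a a' c c') =
      ∑ l, ∑ a, ∑ a', ∑ c, ∑ c', w a a' c c' * (v k l * t k l a a' c c') := by
    intro k
    calc ∑ a, ∑ a', ∑ c, ∑ c', ∑ l, w a a' c c' * (v k l * t k l a a' c c')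
        = ∑ a, ∑ a', ∑ c, ∑ l, ∑ c', w a a' c c' * (v k l * t k l a a' c c') :=
          Finset.sum_congr rfl fun a _ ↦ Finset.sum_congr rfl fun a' _ ↦
            Finset.sum_congr rfl fun c _ ↦ Finset.sum_comm
      _ = ∑ a, ∑ a', ∑ l, ∑ c, ∑ c', w a a' c c' * (v k l * t k l a a' c c') :=
          Finset.sum_congr rfl fun a _ ↦ Finset.sum_congr rfl fun a' _ ↦ Finset.sum_comm
      _ = ∑ a, ∑ l, ∑ a', ∑ c, ∑ c', w a a' c c' * (v k l * t k l a a' c c') :=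
          Finset.sum_congr rfl fun a _ ↦ Finset.sum_comm
      _ = ∑ l, ∑ a, ∑ a', ∑ c, ∑ c', w a a' c c' * (v k l * t k l a a' c c') := Finset.sum_comm
  rw [e1]
  refine Finset.sum_congr rfl fun k _ ↦ ?_
  rw [e2 k]
  refine Finset.sum_congr rfl fun l _ ↦ Finset.sum_congr rfl fun a _ ↦ Finset.sum_congr rfl fun a' _ ↦
    Finset.sum_congr rfl fun c _ ↦ Finset.sum_congr rfl fun c' _ ↦ ?_
  ring

/-- **The Hessian of `|Rm|²`** (Topping 2006, proof of Prop. 3.2.10, the step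
`Δ|Rm|² = 2|∇Rm|² + 2⟨Rm, ΔRm⟩` before tracing): in coordinates,
`Hess |Rm|² (Y,Z) = −Σ g^{aa'}g^{cc'} [tr((∇²_{Y,Z}R)(a,c) R(a',c')) + tr((∇_ZR)(a,c)(∇_YR)(a',c'))
  + tr((∇_YR)(a,c)(∇_ZR)(a',c')) + tr(R(a,c)(∇²_{Y,Z}R)(a',c'))]`,
`Hess = hessAt` the coordinate Hessian. [cite: Topping2006, Prop. 3.2.10 (proof)] -/
theorem IsMetricOn.hessAt_rmNormSqAt (hG : IsMetricOn G V) (hx : x ∈ V) (Y Z : E) :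
    hessAt G (rmNormSqAt G) x Y Z = -∑ a, ∑ a', ∑ c, ∑ c', ginv G b x a a' * ginv G b x c c' *
      (traceCLM E ((cov2RiemAt G x Y Z (b a) (b c)).comp (riemAt G x (b a') (b c')))
        + traceCLM E ((covRiemAt G x Z (b a) (b c)).comp (covRiemAt G x Y (b a') (b c')))
        + traceCLM E ((covRiemAt G x Y (b a) (b c)).comp (covRiemAt G x Z (b a') (b c')))
        + traceCLM E ((riemAt G x (b a) (b c)).comp (cov2RiemAt G x Y Z (b a') (b c')))) := by
  rw [hessAt_apply]
  -- evaluation commutes with differentiation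
  have hD : DifferentiableAt ℝ (fderiv ℝ (rmNormSqAt G)) x :=
    ((hG.contDiffAt_rmNormSqAt hx).fderiv_right (m := ∞) (by simp)).differentiableAt (by simp)
  rw [← fderiv_clm_apply_const hD Z Y]
  -- the first derivative near `x`
  set T : E → E → E → E → E → ℝ := fun y A A' C C' ↦
    traceCLM E ((covRiemAt G y Z A C).comp (riemAt G y A' C'))
      + traceCLM E ((riemAt G y A C).comp (covRiemAt G y Z A' C')) with hTdef
  have heq : (fun y ↦ fderiv ℝ (rmNormSqAt G) y Z) =ᶠ[𝓝 x] fun y ↦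
      -∑ a, ∑ a', ∑ c, ∑ c', ginv G b y a a' * ginv G b y c c' * T y (b a) (b a') (b c) (b c') :=
    (hG.eventually_mem hx).mono fun y hy ↦ by
      beta_reduce
      rw [hG.fderiv_rmNormSqAt b hy Z]
  rw [heq.fderiv_eq]
  -- differentiability of the components
  have hT : ∀ a a' c c', DifferentiableAt ℝ (fun y ↦ T y (b a) (b a') (b c) (b c')) x := by
    intro a a' c c'
    simp only [hTdef]
    exact (((traceCLM E).differentiableAt).comp x ((hG.differentiableAt_covRiemAt hx Z (b a) (b c)).clm_comp
      (hG.differentiableAt_riemAt hx (b a') (b c')))).add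
      (((traceCLM E).differentiableAt).comp x ((hG.differentiableAt_riemAt hx (b a) (b c)).clm_comp
      (hG.differentiableAt_covRiemAt hx Z (b a') (b c'))))
  -- multilinearity of the components at `x`
  have hadd₁ := hG.covRiemAt_add_mid hx
  have hsmul₁ := hG.covRiemAt_smul_mid hx
  have hadd₂ := hG.covRiemAt_add_right hx
  have hsmul₂ := hG.covRiemAt_smul_right hx
  have hTa₁ : ∀ A₁ A₂ A' C C', T x (A₁ + A₂) A' C C' = T x A₁ A' C C' + T x A₂ A' C C' := by
    intros; simp only [hTdef, hadd₁, riemAt_add_left, ContinuousLinearMap.add_comp, map_add]; ring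
  have hTs₁ : ∀ (r : ℝ) A A' C C', T x (r • A) A' C C' = r * T x A A' C C' := by
    intros; simp only [hTdef, hsmul₁, riemAt_smul_left, ContinuousLinearMap.smul_comp, map_smul,
      smul_eq_mul]; ring
  have hTa₂ : ∀ A A₁ A₂ C C', T x A (A₁ + A₂) C C' = T x A A₁ C C' + T x A A₂ C C' := by
    intros; simp only [hTdef, hadd₁, riemAt_add_left, ContinuousLinearMap.comp_add, map_add]; ring
  have hTs₂ : ∀ (r : ℝ) A A' C C', T x A (r • A') C C' = r * T x A A' C C' := by
    intros; simp only [hTdef, hsmul₁, riemAt_smul_left, ContinuousLinearMap.comp_smul, map_smul,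
      smul_eq_mul]; ring
  have hTa₃ : ∀ A A' C₁ C₂ C', T x A A' (C₁ + C₂) C' = T x A A' C₁ C' + T x A A' C₂ C' := by
    intros; simp only [hTdef, hadd₂, riemAt_add_right, ContinuousLinearMap.add_comp, map_add]; ring
  have hTs₃ : ∀ (r : ℝ) A A' C C', T x A A' (r • C) C' = r * T x A A' C C' := by
    intros; simp only [hTdef, hsmul₂, riemAt_smul_right, ContinuousLinearMap.smul_comp, map_smul,
      smul_eq_mul]; ring
  have hTa₄ : ∀ A A' C C₁ C₂, T x A A' C (C₁ + C₂) = T x A A' C C₁ + T x A A' C C₂ := by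
    intros; simp only [hTdef, hadd₂, riemAt_add_right, ContinuousLinearMap.comp_add, map_add]; ring
  have hTs₄ : ∀ (r : ℝ) A A' C C', T x A A' C (r • C') = r * T x A A' C C' := by
    intros; simp only [hTdef, hsmul₂, riemAt_smul_right, ContinuousLinearMap.comp_smul, map_smul,
      smul_eq_mul]; ring
  -- the partial contractions (bilinear)
  set Q₁ : E →ₗ[ℝ] E →ₗ[ℝ] ℝ := LinearMap.mk₂ ℝ
    (fun A A' ↦ ∑ c, ∑ c', ginv G b x c c' * T x A A' (b c) (b c'))
    (fun A₁ A₂ A' ↦ by simp only [hTa₁, mul_add, Finset.sum_add_distrib])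
    (fun r A A' ↦ by
      simp only [hTs₁, smul_eq_mul, Finset.mul_sum]
      exact Finset.sum_congr rfl fun _ _ ↦ Finset.sum_congr rfl fun _ _ ↦ by ring)
    (fun A A₁ A₂ ↦ by simp only [hTa₂, mul_add, Finset.sum_add_distrib])
    (fun r A A' ↦ by
      simp only [hTs₂, smul_eq_mul, Finset.mul_sum]
      exact Finset.sum_congr rfl fun _ _ ↦ Finset.sum_congr rfl fun _ _ ↦ by ring) with hQ₁def
  set Q₂ : E →ₗ[ℝ] E →ₗ[ℝ] ℝ := LinearMap.mk₂ ℝ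
    (fun C C' ↦ ∑ a, ∑ a', ginv G b x a a' * T x (b a) (b a') C C')
    (fun C₁ C₂ C' ↦ by simp only [hTa₃, mul_add, Finset.sum_add_distrib])
    (fun r C C' ↦ by
      simp only [hTs₃, smul_eq_mul, Finset.mul_sum]
      exact Finset.sum_congr rfl fun _ _ ↦ Finset.sum_congr rfl fun _ _ ↦ by ring)
    (fun C C₁ C₂ ↦ by simp only [hTa₄, mul_add, Finset.sum_add_distrib])
    (fun r C C' ↦ by
      simp only [hTs₄, smul_eq_mul, Finset.mul_sum]
      exact Finset.sum_congr rfl fun _ _ ↦ Finset.sum_congr rfl fun _ _ ↦ by ring) with hQ₂def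
  have hQ₁ : ∀ A A', Q₁ A A' = ∑ c, ∑ c', ginv G b x c c' * T x A A' (b c) (b c') := fun _ _ ↦ rfl
  have hQ₂ : ∀ C C', Q₂ C C' = ∑ a, ∑ a', ginv G b x a a' * T x (b a) (b a') C C' := fun _ _ ↦ rfl
  rw [fderiv_fun_neg, _root_.neg_apply, hG.fderiv_sum_ginv_ginv_mul b hx hT Q₁ hQ₁ Q₂ hQ₂ Y]
  set g := ginv G b x with hgdef
  set Γ := chrAt G x Y with hΓ
  -- the derivative of the components
  have hdT : ∀ a a' c c', fderiv ℝ (fun y ↦ T y (b a) (b a') (b c) (b c')) x Y =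
      (traceCLM E ((cov2RiemAt G x Y Z (b a) (b c)).comp (riemAt G x (b a') (b c')))
        + traceCLM E ((covRiemAt G x Z (b a) (b c)).comp (covRiemAt G x Y (b a') (b c')))
        + traceCLM E ((covRiemAt G x Y (b a) (b c)).comp (covRiemAt G x Z (b a') (b c')))
        + traceCLM E ((riemAt G x (b a) (b c)).comp (cov2RiemAt G x Y Z (b a') (b c'))))
      + (traceCLM E ((covRiemAt G x (Γ Z) (b a) (b c)).comp (riemAt G x (b a') (b c')))
        + traceCLM E ((riemAt G x (b a) (b c)).comp (covRiemAt G x (Γ Z) (b a') (b c'))))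
      + (T x (Γ (b a)) (b a') (b c) (b c') + T x (b a) (Γ (b a')) (b c) (b c'))
      + (T x (b a) (b a') (Γ (b c)) (b c') + T x (b a) (b a') (b c) (Γ (b c'))) := by
    intro a a' c c'
    simp only [hTdef]
    rw [fderiv_fun_add, _root_.add_apply,
      fderiv_traceCLM_comp (hG.differentiableAt_covRiemAt hx Z (b a) (b c))
        (hG.differentiableAt_riemAt hx (b a') (b c')),
      fderiv_traceCLM_comp (hG.differentiableAt_riemAt hx (b a) (b c))
        (hG.differentiableAt_covRiemAt hx Z (b a') (b c')),
      fderiv_covRiemAt_eq_cov2RiemAt, fderiv_covRiemAt_eq_cov2RiemAt,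
      fderiv_riemAt_eq_covRiemAt, fderiv_riemAt_eq_covRiemAt]
    rotate_left
    · exact ((traceCLM E).differentiableAt).comp x ((hG.differentiableAt_covRiemAt hx Z (b a) (b c)).clm_comp
        (hG.differentiableAt_riemAt hx (b a') (b c')))
    · exact ((traceCLM E).differentiableAt).comp x ((hG.differentiableAt_riemAt hx (b a) (b c)).clm_comp
        (hG.differentiableAt_covRiemAt hx Z (b a') (b c')))
    simp only [ContinuousLinearMap.add_comp, ContinuousLinearMap.sub_comp,
      ContinuousLinearMap.comp_add, ContinuousLinearMap.comp_sub, map_add, map_sub, hΓ]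
    have hc1 := traceCLM_conj_cancel (chrAt G x Y) (covRiemAt G x Z (b a) (b c)) (riemAt G x (b a') (b c'))
    have hc2 := traceCLM_conj_cancel (chrAt G x Y) (riemAt G x (b a) (b c)) (covRiemAt G x Z (b a') (b c'))
    linear_combination hc1 + hc2
  -- regroup the correction terms
  have hR1 : ∑ a, ∑ a', ∑ c, ∑ c', g a a' * g c c' *
      (T x (Γ (b a)) (b a') (b c) (b c') + T x (b a) (Γ (b a')) (b c) (b c')) =
      ∑ a, ∑ a', g a a' * (Q₁ (Γ (b a)) (b a') + Q₁ (b a) (Γ (b a'))) := by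
    refine Finset.sum_congr rfl fun a _ ↦ Finset.sum_congr rfl fun a' _ ↦ ?_
    rw [hQ₁, hQ₁, mul_add, Finset.mul_sum, Finset.mul_sum, ← Finset.sum_add_distrib]
    refine Finset.sum_congr rfl fun c _ ↦ ?_
    rw [Finset.mul_sum, Finset.mul_sum, ← Finset.sum_add_distrib]
    exact Finset.sum_congr rfl fun c' _ ↦ by ring
  have hR2 : ∑ a, ∑ a', ∑ c, ∑ c', g a a' * g c c' *
      (T x (b a) (b a') (Γ (b c)) (b c') + T x (b a) (b a') (b c) (Γ (b c'))) =
      ∑ c, ∑ c', g c c' * (Q₂ (Γ (b c)) (b c') + Q₂ (b c) (Γ (b c'))) := by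
    rw [sum_comm_pairs]
    refine Finset.sum_congr rfl fun c _ ↦ Finset.sum_congr rfl fun c' _ ↦ ?_
    rw [hQ₂, hQ₂, mul_add, Finset.mul_sum, Finset.mul_sum, ← Finset.sum_add_distrib]
    refine Finset.sum_congr rfl fun a _ ↦ ?_
    rw [Finset.mul_sum, Finset.mul_sum, ← Finset.sum_add_distrib]
    exact Finset.sum_congr rfl fun a' _ ↦ by ring
  -- the `Γ(Y,Z)` terms are `−du(Γ(Y,Z))`
  have hΓZ := hG.fderiv_rmNormSqAt b hx (Γ Z)
  rw [hΓZ]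
  simp only [hdT, mul_add, Finset.sum_add_distrib] at hR1 hR2 ⊢
  linarith

/-- **The Laplacian of `|Rm|²`** (Topping 2006, proof of Prop. 3.2.10:
`Δ|Rm|² = 2|∇Rm|² + 2⟨Rm, ΔRm⟩`): in coordinates, with `ΔR = lapRiemAt`,
`Δ |Rm|²_G = −2 Σ g^{aa'}g^{cc'} tr((ΔR)(a,c) R(a',c'))
   − 2 Σ g^{kl} Σ g^{aa'}g^{cc'} tr((∇_k R)(a,c)(∇_l R)(a',c'))`
(the second sum is `−|∇Rm|²` in an orthonormal frame, `sum_ginv_traceCLM_covRiemAt_nonpos`).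
[cite: Topping2006, Prop. 3.2.10 (proof)] -/
theorem IsMetricOn.lapAt_rmNormSqAt (hG : IsMetricOn G V) (hx : x ∈ V) :
    lapAt G (rmNormSqAt G) x =
      -2 * ∑ a, ∑ a', ∑ c, ∑ c', ginv G b x a a' * ginv G b x c c' *
          traceCLM E ((lapRiemAt G b x (b a) (b c)).comp (riemAt G x (b a') (b c')))
      - 2 * ∑ k, ∑ l, ginv G b x k l * ∑ a, ∑ a', ∑ c, ∑ c', ginv G b x a a' * ginv G b x c c' *
          traceCLM E ((covRiemAt G x (b k) (b a) (b c)).comp (covRiemAt G x (b l) (b a') (b c'))) := by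
  have hi := hG.isInvertible x hx
  have hgs : ∀ i j, ginv G b x i j = ginv G b x j i := fun i j ↦ ginv_comm b hi (hG.symm x hx) i j
  rw [lapAt_eq_sum G b]
  simp only [← hessAt_apply, hG.hessAt_rmNormSqAt b hx]
  set g := ginv G b x with hgdef
  -- the four sums
  set S₁ := ∑ k, ∑ l, g k l * ∑ a, ∑ a', ∑ c, ∑ c', g a a' * g c c' *
    traceCLM E ((cov2RiemAt G x (b k) (b l) (b a) (b c)).comp (riemAt G x (b a') (b c'))) with hS₁
  set S₂ := ∑ k, ∑ l, g k l * ∑ a, ∑ a', ∑ c, ∑ c', g a a' * g c c' *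
    traceCLM E ((covRiemAt G x (b l) (b a) (b c)).comp (covRiemAt G x (b k) (b a') (b c'))) with hS₂
  set S₃ := ∑ k, ∑ l, g k l * ∑ a, ∑ a', ∑ c, ∑ c', g a a' * g c c' *
    traceCLM E ((covRiemAt G x (b k) (b a) (b c)).comp (covRiemAt G x (b l) (b a') (b c'))) with hS₃
  set S₄ := ∑ k, ∑ l, g k l * ∑ a, ∑ a', ∑ c, ∑ c', g a a' * g c c' *
    traceCLM E ((riemAt G x (b a) (b c)).comp (cov2RiemAt G x (b k) (b l) (b a') (b c'))) with hS₄
  have hsplit : ∑ k, ∑ l, g k l * -∑ a, ∑ a', ∑ c, ∑ c', g a a' * g c c' *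
      (traceCLM E ((cov2RiemAt G x (b k) (b l) (b a) (b c)).comp (riemAt G x (b a') (b c')))
        + traceCLM E ((covRiemAt G x (b l) (b a) (b c)).comp (covRiemAt G x (b k) (b a') (b c')))
        + traceCLM E ((covRiemAt G x (b k) (b a) (b c)).comp (covRiemAt G x (b l) (b a') (b c')))
        + traceCLM E ((riemAt G x (b a) (b c)).comp (cov2RiemAt G x (b k) (b l) (b a') (b c'))))
      = -(S₁ + S₂ + S₃ + S₄) := by
    simp only [hS₁, hS₂, hS₃, hS₄, mul_add, Finset.sum_add_distrib, mul_neg, Finset.sum_neg_distrib,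
      Finset.mul_sum, neg_add]
  rw [hsplit]
  -- `S₄ = S₁` by `tr(AB) = tr(BA)` and relabelling
  have h41 : S₄ = S₁ := by
    simp only [hS₄, hS₁]
    refine Finset.sum_congr rfl fun k _ ↦ Finset.sum_congr rfl fun l _ ↦ ?_
    congr 1
    rw [← sum_ginv_ginv_swap hgs]
    refine Finset.sum_congr rfl fun a _ ↦ Finset.sum_congr rfl fun a' _ ↦
      Finset.sum_congr rfl fun c _ ↦ Finset.sum_congr rfl fun c' _ ↦ ?_
    rw [traceCLM_comp_comm]
  -- `S₂ = S₃` by relabelling `k ↔ l`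
  have h23 : S₂ = S₃ := by
    simp only [hS₂, hS₃]
    rw [Finset.sum_comm]
    exact Finset.sum_congr rfl fun k _ ↦ Finset.sum_congr rfl fun l _ ↦ by rw [hgs l k]
  -- `S₁ = Σ gg tr((ΔR) R')`
  have h1 : S₁ = ∑ a, ∑ a', ∑ c, ∑ c', g a a' * g c c' *
      traceCLM E ((lapRiemAt G b x (b a) (b c)).comp (riemAt G x (b a') (b c'))) := by
    simp only [hS₁]
    have hlap : ∀ a a' c c', traceCLM E ((lapRiemAt G b x (b a) (b c)).comp (riemAt G x (b a') (b c'))) =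
        ∑ k, ∑ l, g k l * traceCLM E ((cov2RiemAt G x (b k) (b l) (b a) (b c)).comp
          (riemAt G x (b a') (b c'))) := by
      intro a a' c c'
      rw [lapRiemAt, show traceCLM E ((∑ k, ∑ l, ginv G b x k l • cov2RiemAt G x (b k) (b l) (b a) (b c)).comp
        (riemAt G x (b a') (b c'))) = (trCompCLM E).flip (riemAt G x (b a') (b c'))
          (∑ k, ∑ l, ginv G b x k l • cov2RiemAt G x (b k) (b l) (b a) (b c)) from rfl]
      simp only [map_sum, map_smul, smul_eq_mul, flip_apply, trCompCLM_apply, hgdef]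
    simp only [hlap]
    exact (sum₄_mul_sum₂ (fun a a' c c' ↦ g a a' * g c c') g (fun k l a a' c c' ↦
      traceCLM E ((cov2RiemAt G x (b k) (b l) (b a) (b c)).comp (riemAt G x (b a') (b c'))))).symm
  rw [h41, h23, h1, hS₃]
  ring

end SecondDerivative

/-! ### Joint smoothness of `|Rm|²` along a smooth family -/

namespace IsMetricFamilyOn

section FamilySmooth

variable [FiniteDimensional ℝ E] [CompleteSpace E]
  {G : ℝ → E → E →L[ℝ] E →L[ℝ] ℝ} {S : Set ℝ} {V : Set E}

omit [FiniteDimensional ℝ E] in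
/-- `(y, t) ↦ ♯_t(y) = (G t y)⁻¹` is `C^∞` on `V × S`. [folklore] -/
theorem contDiffOn_sharpAt_family (hG : IsMetricFamilyOn G S V) :
    ContDiffOn ℝ ∞ (fun q : E × ℝ ↦ sharpAt (G q.2) q.1) (V ×ˢ S) := fun q hq ↦
  (((hG.isMetricOn q.2 hq.2).isInvertible q.1 hq.1).contDiffAt_map_inverse.comp_contDiffWithinAt
    q (hG.contDiffOn q hq) :)

omit [FiniteDimensional ℝ E] in
/-- `(y, t) ↦ R_t(y)(X, Y)` is `C^∞` on `V × S` (joint smoothness of `Γ` and of `D_yΓ`). [folklore] -/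
theorem contDiffOn_riemAt_family (hG : IsMetricFamilyOn G S V) (X Y : E) :
    ContDiffOn ℝ ∞ (fun q : E × ℝ ↦ riemAt (G q.2) q.1 X Y) (V ×ˢ S) := by
  by_cases hS : S = ∅
  · simp [hS]
  obtain ⟨t₀, ht₀⟩ := Set.nonempty_iff_ne_empty.mpr hS
  have hV := hG.isOpen ht₀
  have hΓ := hG.contDiffOn_chrAt_family
  have hD : ContDiffOn ℝ ∞ (fun q : E × ℝ ↦ fderiv ℝ (chrAt (G q.2)) q.1) (V ×ˢ S) :=
    contDiffOn_fderiv_slice (F := fun q : E × ℝ ↦ chrAt (G q.2) q.1) hV hG.uniqueDiffOn hΓ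
  have h1 : ∀ A B : E, ContDiffOn ℝ ∞ (fun q : E × ℝ ↦ fderiv ℝ (chrAt (G q.2)) q.1 A B) (V ×ˢ S) :=
    fun A B ↦ (hD.clm_apply contDiffOn_const).clm_apply contDiffOn_const
  have h2 : ∀ A : E, ContDiffOn ℝ ∞ (fun q : E × ℝ ↦ chrAt (G q.2) q.1 A) (V ×ˢ S) := fun A ↦
    hΓ.clm_apply contDiffOn_const
  simp only [riemAt]
  exact (((h1 X Y).sub (h1 Y X)).add ((h2 X).clm_comp (h2 Y))).sub ((h2 Y).clm_comp (h2 X))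

/-- **`|Rm|²` of a smooth family is jointly smooth**: `(y, t) ↦ |Rm|²_{G t}(y)` is `C^∞` on `V × S`
(Topping 2006, §1.2.3: all curvature quantities of a smooth family are smooth on space-time).
[cite: Topping2006, §1.2.3] -/
theorem contDiffOn_rmNormSqAt_family (hG : IsMetricFamilyOn G S V) :
    ContDiffOn ℝ ∞ (fun q : E × ℝ ↦ rmNormSqAt (G q.2) q.1) (V ×ˢ S) := by
  set b₀ := Module.finBasis ℝ E
  have heq : (fun q : E × ℝ ↦ rmNormSqAt (G q.2) q.1) = fun q ↦ -∑ a, ∑ a', ∑ c, ∑ c',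
      ginv (G q.2) b₀ q.1 a a' * ginv (G q.2) b₀ q.1 c c' *
        traceCLM E ((riemAt (G q.2) q.1 (b₀ a) (b₀ c)).comp (riemAt (G q.2) q.1 (b₀ a') (b₀ c'))) :=
    funext fun q ↦ rmNormSqAt_eq_sum b₀
  rw [heq]
  have hginv : ∀ i j, ContDiffOn ℝ ∞ (fun q : E × ℝ ↦ ginv (G q.2) b₀ q.1 i j) (V ×ˢ S) := fun i j ↦
    (coordCLM b₀ i).contDiff.comp_contDiffOn (hG.contDiffOn_sharpAt_family.clm_apply contDiffOn_const)
  refine ContDiffOn.neg (ContDiffOn.sum fun a _ ↦ ContDiffOn.sum fun a' _ ↦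
    ContDiffOn.sum fun c _ ↦ ContDiffOn.sum fun c' _ ↦ ?_)
  exact ((hginv a a').mul (hginv c c')).mul ((traceCLM E).contDiff.comp_contDiffOn
    ((hG.contDiffOn_riemAt_family (b₀ a) (b₀ c)).clm_comp (hG.contDiffOn_riemAt_family (b₀ a') (b₀ c'))))

end FamilySmooth

end IsMetricFamilyOn

/-! ### The time derivative of `|Rm|²` under the flow -/

namespace IsMetricFamilyOn

section TimeDerivative

variable {ι : Type*} [Fintype ι] [FiniteDimensional ℝ E] [CompleteSpace E]
  {G : ℝ → E → E →L[ℝ] E →L[ℝ] ℝ} {S : Set ℝ} {V : Set E} {x : E} {t : ℝ} (b : Basis ι ℝ E)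
  (hG : IsMetricFamilyOn G S V)
  (hfl : ∀ s ∈ S, ∀ y ∈ V, tDeriv G S s y = (-2 : ℝ) • ricAt (G s) y)
include hG hfl

/-- **`∂_t g^{kl} = 2 Ric^{kl}` under the flow** (Topping 2006, proof of Prop. 3.2.10:
"`∂_t g^{ij} = −h^{ij} = 2R^{ij}`"): within `S`,
`∂_t g^{kl} = 2 Σ_{cd} g^{kc} Ric(b_c,b_d) g^{dl}`. [cite: Topping2006, Prop. 3.2.10 (proof)] -/
theorem hasDerivWithinAt_ginv_ricciFlow (hx : x ∈ V) (ht : t ∈ S) (k l : ι) :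
    HasDerivWithinAt (fun s ↦ ginv (G s) b x k l)
      (2 * ∑ c, ∑ d, ginv (G t) b x k c * ricAt (G t) x (b c) (b d) * ginv (G t) b x d l) S t := by
  have hGt := hG.isMetricOn t ht
  refine (hG.hasDerivWithinAt_ginv b hx ht k l).congr_deriv ?_
  -- `♯ bˡ = Σ_d g^{dl} b_d`
  have hsharp : sharpAt (G t) x (coordCLM b l) = ∑ d, ginv (G t) b x d l • b d := by
    conv_lhs => rw [← sum_coord_smul b (sharpAt (G t) x (coordCLM b l))]
    rfl
  rw [map_neg, coord_sharpAt_eq_sum b, hfl t ht x hx, Finset.mul_sum, ← Finset.sum_neg_distrib]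
  refine Finset.sum_congr rfl fun c _ ↦ ?_
  rw [hsharp, map_sum, _root_.sum_apply, Finset.mul_sum, Finset.mul_sum, ← Finset.sum_neg_distrib]
  refine Finset.sum_congr rfl fun d _ ↦ ?_
  rw [map_smul, _root_.smul_apply, _root_.smul_apply, _root_.smul_apply, smul_eq_mul, smul_eq_mul,
    hGt.ricAt_comm hx (b d) (b c)]
  ring

omit hfl in
/-- **The time derivative of the trace pairing of curvature endomorphisms**: within `S`,
`∂_t tr(R(A,C) R(A',C')) = tr(∂_tR(A,C) R(A',C')) + tr(R(A,C) ∂_tR(A',C'))`, `∂_t R = varRiemAt`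
(Prop. 2.3.4). [cite: Topping2006, Prop. 2.3.4] -/
theorem hasDerivWithinAt_traceCLM_riemAt_comp (hx : x ∈ V) (ht : t ∈ S) (A C A' C' : E) :
    HasDerivWithinAt (fun s ↦ traceCLM E ((riemAt (G s) x A C).comp (riemAt (G s) x A' C')))
      (traceCLM E ((varRiemAt G S t x A C).comp (riemAt (G t) x A' C'))
        + traceCLM E ((riemAt (G t) x A C).comp (varRiemAt G S t x A' C'))) S t := by
  have h := (traceCLM E).hasFDerivAt.comp_hasDerivWithinAt t
    ((hG.hasDerivWithinAt_riemAt hx ht A C).clm_comp (hG.hasDerivWithinAt_riemAt hx ht A' C'))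
  refine (h.congr_deriv ?_)
  simp only [map_add]

/-- **The time derivative of `|Rm|²` under the flow** (Topping 2006, proof of Prop. 3.2.10, the
first display: `∂_t|Rm|² = (∂_t g⁻¹) * Rm * Rm + 2⟨Rm, ∂_tRm⟩`): within `S`,
`∂_t |Rm|²_G = −Σ (∂_tg^{aa'} g^{cc'} + g^{aa'} ∂_tg^{cc'}) tr(R(a,c)R(a',c'))
   − Σ g^{aa'}g^{cc'} [tr(∂_tR(a,c) R(a',c')) + tr(R(a,c) ∂_tR(a',c'))]`,
with `∂_t g^{kl} = 2 Σ g^{kc} Ric_{cd} g^{dl}` and `∂_t R = varRiemAt`.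
[cite: Topping2006, Prop. 3.2.10 (proof)] -/
theorem hasDerivWithinAt_rmNormSqAt (hx : x ∈ V) (ht : t ∈ S) :
    HasDerivWithinAt (fun s ↦ rmNormSqAt (G s) x)
      (-(∑ a, ∑ a', ∑ c, ∑ c',
          ((2 * ∑ p, ∑ q, ginv (G t) b x a p * ricAt (G t) x (b p) (b q) * ginv (G t) b x q a')
              * ginv (G t) b x c c'
            + ginv (G t) b x a a'
              * (2 * ∑ p, ∑ q, ginv (G t) b x c p * ricAt (G t) x (b p) (b q) * ginv (G t) b x q c'))
            * traceCLM E ((riemAt (G t) x (b a) (b c)).comp (riemAt (G t) x (b a') (b c')))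
        + ∑ a, ∑ a', ∑ c, ∑ c', ginv (G t) b x a a' * ginv (G t) b x c c' *
          (traceCLM E ((varRiemAt G S t x (b a) (b c)).comp (riemAt (G t) x (b a') (b c')))
            + traceCLM E ((riemAt (G t) x (b a) (b c)).comp (varRiemAt G S t x (b a') (b c')))))) S t := by
  have heq : (fun s ↦ rmNormSqAt (G s) x) = fun s ↦ -∑ a, ∑ a', ∑ c, ∑ c',
      ginv (G s) b x a a' * ginv (G s) b x c c' *
        traceCLM E ((riemAt (G s) x (b a) (b c)).comp (riemAt (G s) x (b a') (b c'))) :=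
    funext fun s ↦ rmNormSqAt_eq_sum b
  rw [heq]
  have hg := hG.hasDerivWithinAt_ginv_ricciFlow b hfl hx ht
  have hT := hG.hasDerivWithinAt_traceCLM_riemAt_comp hx ht
  have hterm : ∀ a a' c c', HasDerivWithinAt (fun s ↦ ginv (G s) b x a a' * ginv (G s) b x c c' *
      traceCLM E ((riemAt (G s) x (b a) (b c)).comp (riemAt (G s) x (b a') (b c'))))
      (((2 * ∑ p, ∑ q, ginv (G t) b x a p * ricAt (G t) x (b p) (b q) * ginv (G t) b x q a')
          * ginv (G t) b x c c'
        + ginv (G t) b x a a'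
          * (2 * ∑ p, ∑ q, ginv (G t) b x c p * ricAt (G t) x (b p) (b q) * ginv (G t) b x q c'))
          * traceCLM E ((riemAt (G t) x (b a) (b c)).comp (riemAt (G t) x (b a') (b c')))
        + ginv (G t) b x a a' * ginv (G t) b x c c' *
          (traceCLM E ((varRiemAt G S t x (b a) (b c)).comp (riemAt (G t) x (b a') (b c')))
            + traceCLM E ((riemAt (G t) x (b a) (b c)).comp (varRiemAt G S t x (b a') (b c'))))) S t := by
    intro a a' c c'
    have h := ((hg a a').fun_mul (hg c c')).fun_mul (hT (b a) (b c) (b a') (b c'))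
    refine h.congr_deriv ?_
    ring
  have hsum := HasDerivWithinAt.fun_sum (u := Finset.univ) fun a _ ↦
    HasDerivWithinAt.fun_sum (u := Finset.univ) fun a' _ ↦
      HasDerivWithinAt.fun_sum (u := Finset.univ) fun c _ ↦
        HasDerivWithinAt.fun_sum (u := Finset.univ) fun c' (_ : c' ∈ Finset.univ) ↦ hterm a a' c c'
  refine hsum.neg.congr_deriv ?_
  simp only [Finset.sum_add_distrib, neg_add]

/-- **`tr(∂_tR(A,C) B)` through the Laplacian** (Prop. 2.5.1, `apply_varRiemAt_of_flow`, traced):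
for every endomorphism `B`,
`tr(∂_tR(A,C) ∘ B) = tr((ΔR)(A,C) ∘ B) + Σ g^{ij} [Q(A,C,Bb_i,b_j) − Q(C,A,Bb_i,b_j)
  + Ric(R(A,C)Bb_i, b_j) + Ric(Bb_i, R(A,C)b_j)]`. [cite: Topping2006, Prop. 2.5.1] -/
theorem traceCLM_varRiemAt_comp (hx : x ∈ V) (ht : t ∈ S) (A C : E) (B : E →L[ℝ] E) :
    traceCLM E ((varRiemAt G S t x A C).comp B) =
      traceCLM E ((lapRiemAt (G t) b x A C).comp B)
        + ∑ i, ∑ j, ginv (G t) b x i j *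
          (quadRiemAt (G t) b x A C (B (b i)) (b j) - quadRiemAt (G t) b x C A (B (b i)) (b j)
            + ricAt (G t) x (riemAt (G t) x A C (B (b i))) (b j)
            + ricAt (G t) x (B (b i)) (riemAt (G t) x A C (b j))) := by
  have hi := (hG.isMetricOn t ht).isInvertible x hx
  rw [traceCLM_apply, traceCLM_apply, trace_eq_sum_ginv b hi, trace_eq_sum_ginv b hi,
    ← Finset.sum_add_distrib]
  refine Finset.sum_congr rfl fun i _ ↦ ?_
  rw [← Finset.sum_add_distrib]
  refine Finset.sum_congr rfl fun j _ ↦ ?_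
  simp only [ContinuousLinearMap.coe_coe, ContinuousLinearMap.comp_apply,
    hG.apply_varRiemAt_of_flow b hfl hx ht]
  ring

end TimeDerivative

end IsMetricFamilyOn

/-! ### Estimates in an orthonormal basis -/

section OrthonormalEstimates

variable {ι : Type*} [Fintype ι] [DecidableEq ι] [FiniteDimensional ℝ E] [CompleteSpace E]
  {G : E → E →L[ℝ] E →L[ℝ] ℝ} {V : Set E} {x : E}
  (e : Basis ι ℝ E) (he : ∀ i j, G x (e i) (e j) = if i = j then 1 else 0)
include he

omit [FiniteDimensional ℝ E] [CompleteSpace E] in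
/-- Applying an endomorphism with bounded components to a vector with bounded components:
`|G(A v, e_j)| ≤ n ν M`. [folklore] -/
theorem abs_apply_vec_le {A : E →L[ℝ] E} {M ν : ℝ} (hA : ∀ i j, |G x (A (e i)) (e j)| ≤ M)
    {v : E} (hv : ∀ p, |G x v (e p)| ≤ ν) (j : ι) : |G x (A v) (e j)| ≤ Fintype.card ι * (ν * M) := by
  conv_lhs => rw [← sum_apply_smul_of_orthonormal e he v]
  simp only [map_sum, map_smul, _root_.sum_apply, _root_.smul_apply, smul_eq_mul]
  refine (Finset.abs_sum_le_sum_abs _ _).trans ?_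
  calc ∑ p, |G x v (e p) * G x (A (e p)) (e j)| ≤ ∑ _p : ι, ν * M := Finset.sum_le_sum fun p _ ↦ by
        rw [abs_mul]; exact mul_le_mul (hv p) (hA p j) (abs_nonneg _) ((abs_nonneg _).trans (hv p))
    _ = Fintype.card ι * (ν * M) := by simp [Finset.sum_const, Finset.card_univ]

omit [CompleteSpace E] in
/-- Collapsing a double contraction in an orthonormal basis:
`Σ g^{aa'}g^{cc'} F(a,a',c,c') = Σ_{ac} F(a,a,c,c)`. [folklore] -/
theorem sum_ginv_ginv_collapse (hx : (G x).IsInvertible) (F : ι → ι → ι → ι → ℝ) :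
    ∑ a, ∑ a', ∑ c, ∑ c', ginv G e x a a' * ginv G e x c c' * F a a' c c' = ∑ a, ∑ c, F a a c c := by
  refine Finset.sum_congr rfl fun a _ ↦ ?_
  calc ∑ a', ∑ c, ∑ c', ginv G e x a a' * ginv G e x c c' * F a a' c c'
      = ∑ a', ginv G e x a a' * ∑ c, ∑ c', ginv G e x c c' * F a a' c c' := by
        refine Finset.sum_congr rfl fun a' _ ↦ ?_
        rw [Finset.mul_sum]
        refine Finset.sum_congr rfl fun c _ ↦ ?_
        rw [Finset.mul_sum]
        exact Finset.sum_congr rfl fun c' _ ↦ by ring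
    _ = ∑ c, ∑ c', ginv G e x c c' * F a a c c' := sum_ginv_mul_of_orthonormal e he hx _ a
    _ = ∑ c, F a a c c := Finset.sum_congr rfl fun c _ ↦ sum_ginv_mul_of_orthonormal e he hx _ c

omit [CompleteSpace E] in
/-- Collapsing a single contraction in an orthonormal basis: `Σ g^{kl} F(k,l) = Σ_k F(k,k)`.
[folklore] -/
theorem sum_ginv_collapse (hx : (G x).IsInvertible) (F : ι → ι → ℝ) :
    ∑ k, ∑ l, ginv G e x k l * F k l = ∑ k, F k k :=
  Finset.sum_congr rfl fun k _ ↦ sum_ginv_mul_of_orthonormal e he hx _ k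

omit [CompleteSpace E] in
/-- In an orthonormal basis `tr(A A) ≤ 0` for a `G`-skew endomorphism (`= −Σ A_{ij}²`). [folklore] -/
theorem traceCLM_comp_self_nonpos {A : E →L[ℝ] E} (hA : ∀ v w, G x (A v) w = -G x (A w) v) :
    traceCLM E (A.comp A) ≤ 0 := by
  rw [traceCLM_eq_sum_of_orthonormal e he]
  refine Finset.sum_nonpos fun i _ ↦ ?_
  rw [ContinuousLinearMap.comp_apply, apply_comp_of_orthonormal e he]
  refine Finset.sum_nonpos fun m _ ↦ ?_
  rw [hA (e m) (e i)]
  nlinarith [sq_nonneg (G x (A (e i)) (e m))]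

omit [CompleteSpace E] in
/-- The trace pairing of two endomorphisms with bounded components: `|tr(A B)| ≤ n² M M'`.
[folklore] -/
theorem abs_traceCLM_comp_le {A B : E →L[ℝ] E} {M M' : ℝ} (hA : ∀ i j, |G x (A (e i)) (e j)| ≤ M)
    (hB : ∀ i j, |G x (B (e i)) (e j)| ≤ M') :
    |traceCLM E (A.comp B)| ≤ Fintype.card ι * (Fintype.card ι * (M' * M)) :=
  abs_traceCLM_le e he fun i j ↦ by
    rw [ContinuousLinearMap.comp_apply]; exact abs_apply_comp_le e he hA hB i j

omit [CompleteSpace E] in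
/-- **The quadratic term in an orthonormal basis**: with
`Q_k(A,C) = R(e_k,A)R(C,e_k) − R(C,e_k)R(e_k,A) − R(R(e_k,A)C, e_k) − R(C, R(e_k,A)e_k)`,
`quadRiemAt(A,C,Z,W) = Σ_k G(Q_k(A,C) Z, W)`. [cite: Topping2006, §2.4, (2.4.2)] -/
theorem quadRiemAt_of_orthonormal (hx : (G x).IsInvertible) (A C Z W : E) :
    quadRiemAt G e x A C Z W = ∑ k, G x (((riemAt G x (e k) A).comp (riemAt G x C (e k))
      - (riemAt G x C (e k)).comp (riemAt G x (e k) A)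
      - riemAt G x (riemAt G x (e k) A C) (e k) - riemAt G x C (riemAt G x (e k) A (e k))) Z) W := by
  unfold quadRiemAt
  exact sum_ginv_collapse e he hx _

end OrthonormalEstimates

/-! ### The differential inequality for `|Rm|²` (Topping 2006, Prop. 3.2.10) -/

/-- The constant of the weakened curvature-norm evolution inequality
`∂_t|Rm|² ≤ Δ|Rm|² + C(n)|Rm|³` obtained from the coordinate computation:
`C(n) = 22 n⁶ + 2 n⁷` (any explicit polynomial would do; Topping 2006, Prop. 3.2.10: "`C = C(n)`").
[cite: Topping2006, Prop. 3.2.10] -/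
def rmEvolutionConst (n : ℕ) : ℝ := 22 * (n : ℝ) ^ 6 + 2 * (n : ℝ) ^ 7

/-- The constant is nonnegative. [folklore] -/
theorem rmEvolutionConst_nonneg (n : ℕ) : 0 ≤ rmEvolutionConst n := by
  unfold rmEvolutionConst; positivity

namespace IsMetricFamilyOn

section Inequality

variable [FiniteDimensional ℝ E] [CompleteSpace E]
  {G : ℝ → E → E →L[ℝ] E →L[ℝ] ℝ} {S : Set ℝ} {V : Set E} {x : E} {t : ℝ}
  (hG : IsMetricFamilyOn G S V)
  (hfl : ∀ s ∈ S, ∀ y ∈ V, tDeriv G S s y = (-2 : ℝ) • ricAt (G s) y)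
include hG hfl
set_option maxHeartbeats 400000 in -- buildfix (bf3-g26): 160k/180k FAIL, 200k PASS at accept time; line-neutral budget line
/-- **Topping 2006, Prop. 3.2.10 (weakened), in coordinates: the evolution inequality for `|Rm|²`
under the Ricci flow.** Along a smooth family of metric components solving `∂G/∂t = −2 Ric(G)` on
`V × S`, at every `t ∈ S` and every `x ∈ V` at which `G t x` is positive definite,
`∂_t |Rm|² ≤ Δ |Rm|² + C(n) |Rm|² √(|Rm|²)`, i.e. `∂_t|Rm|² ≤ Δ|Rm|² + C|Rm|³` ((3.2.4) with the
term `−2|∇Rm|² ≤ 0` dropped), where `|Rm|² = rmNormSqAt`, `Δ = lapAt (G t)` is the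
Laplace–Beltrami operator of the components, `∂_t` the derivative within `S` (one-sided at the
end points) and `C(n) = rmEvolutionConst (dim E)`. Proof as printed: `∂_t|Rm|² = (∂_tg⁻¹)*Rm*Rm
+ 2⟨Rm, ΔRm + Rm*Rm⟩` (`hasDerivWithinAt_rmNormSqAt`, Prop. 2.5.1), `Δ|Rm|² = 2|∇Rm|² + 2⟨Rm,ΔRm⟩`
(`lapAt_rmNormSqAt`), and in a `G_t(x)`-orthonormal basis `|∇Rm|² ≥ 0` while every cubic term is
bounded by a dimensional multiple of `|Rm|³`. [cite: Topping2006, Prop. 3.2.10] -/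
theorem derivWithin_rmNormSqAt_le (hx : x ∈ V) (ht : t ∈ S) (hpos : ∀ v : E, v ≠ 0 → 0 < G t x v v) :
    derivWithin (fun s ↦ rmNormSqAt (G s) x) S t ≤
      lapAt (G t) (rmNormSqAt (G t)) x
        + rmEvolutionConst (finrank ℝ E) * (rmNormSqAt (G t) x * Real.sqrt (rmNormSqAt (G t) x)) := by
  classical
  have hGt := hG.isMetricOn t ht
  have hi := hGt.isInvertible x hx
  have hs := hGt.symm x hx
  obtain ⟨e, he⟩ := exists_orthonormal_basis hs hpos
  -- notation and scalar facts
  set n : ℝ := (Fintype.card (Fin (finrank ℝ E)) : ℝ) with hn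
  have hncard : (Fintype.card (Fin (finrank ℝ E)) : ℝ) = (finrank ℝ E : ℝ) := by simp
  set u := rmNormSqAt (G t) x with hu
  set K := Real.sqrt u with hK
  have hu0 : 0 ≤ u := hGt.rmNormSqAt_nonneg e he hx
  have hK0 : 0 ≤ K := Real.sqrt_nonneg _
  have hKsq : K ^ 2 = u := Real.sq_sqrt hu0
  have hK3 : K ^ 3 = u * K := by rw [pow_succ, hKsq]
  -- component bounds
  have hRK : ∀ a c i j, |G t x (riemAt (G t) x (e a) (e c) (e i)) (e j)| ≤ K :=
    fun a c i j ↦ hGt.abs_rm_le_sqrt e he hx a c i j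
  have hRK' : ∀ a c i j, |G t x (riemCLM (G t) x (e a) (e c) (e i)) (e j)| ≤ K :=
    fun a c i j ↦ by rw [riemCLM_apply]; exact hRK a c i j
  have hRic : ∀ a c, |ricAt (G t) x (e a) (e c)| ≤ n * K := fun a c ↦ abs_ricAt_le e he hRK a c
  have h1 : ∀ i p, |G t x (e i) (e p)| ≤ 1 := fun i p ↦ by
    rw [he]; split_ifs <;> simp
  -- (1) the time derivative and the Laplacian in the basis `e`
  have hD := (hG.hasDerivWithinAt_rmNormSqAt e hfl hx ht).derivWithin (hG.uniqueDiffOn t ht)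
  rw [hD, hGt.lapAt_rmNormSqAt e hx]
  -- collapse the contraction in `∂_t g⁻¹`
  have hdg : ∀ k l, (2 : ℝ) * ∑ p, ∑ q, ginv (G t) e x k p * ricAt (G t) x (e p) (e q) * ginv (G t) e x q l
      = 2 * ricAt (G t) x (e k) (e l) := by
    intro k l
    congr 1
    calc ∑ p, ∑ q, ginv (G t) e x k p * ricAt (G t) x (e p) (e q) * ginv (G t) e x q l
        = ∑ p, ginv (G t) e x k p * ∑ q, ginv (G t) e x l q * ricAt (G t) x (e p) (e q) := by
          refine Finset.sum_congr rfl fun p _ ↦ ?_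
          rw [Finset.mul_sum]
          exact Finset.sum_congr rfl fun q _ ↦ by
            rw [ginv_comm e hi hs q l]; ring
      _ = ∑ p, ginv (G t) e x k p * ricAt (G t) x (e p) (e l) :=
          Finset.sum_congr rfl fun p _ ↦ by rw [sum_ginv_mul_of_orthonormal e he hi]
      _ = ricAt (G t) x (e k) (e l) := sum_ginv_mul_of_orthonormal e he hi _ k
  simp only [hdg]
  -- name the four sums of the goal
  set J1 := ∑ a, ∑ a', ∑ c, ∑ c', (2 * ricAt (G t) x (e a) (e a') * ginv (G t) e x c c'
      + ginv (G t) e x a a' * (2 * ricAt (G t) x (e c) (e c'))) *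
      traceCLM E ((riemAt (G t) x (e a) (e c)).comp (riemAt (G t) x (e a') (e c'))) with hJ1
  set Vt := ∑ a, ∑ a', ∑ c, ∑ c', ginv (G t) e x a a' * ginv (G t) e x c c' *
      (traceCLM E ((varRiemAt G S t x (e a) (e c)).comp (riemAt (G t) x (e a') (e c')))
        + traceCLM E ((riemAt (G t) x (e a) (e c)).comp (varRiemAt G S t x (e a') (e c')))) with hVt
  set Lt := ∑ a, ∑ a', ∑ c, ∑ c', ginv (G t) e x a a' * ginv (G t) e x c c' *
      traceCLM E ((lapRiemAt (G t) e x (e a) (e c)).comp (riemAt (G t) x (e a') (e c'))) with hLt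
  set Nt := ∑ k, ∑ l, ginv (G t) e x k l * ∑ a, ∑ a', ∑ c, ∑ c', ginv (G t) e x a a' * ginv (G t) e x c c' *
      traceCLM E ((covRiemAt (G t) x (e k) (e a) (e c)).comp (covRiemAt (G t) x (e l) (e a') (e c'))) with hNt
  -- (2) `Nt ≤ 0` (it is `−|∇Rm|²`)
  have hN : Nt ≤ 0 := by
    simp only [hNt]
    rw [sum_ginv_collapse e he hi]
    refine Finset.sum_nonpos fun k _ ↦ ?_
    rw [sum_ginv_ginv_collapse e he hi]
    refine Finset.sum_nonpos fun a _ ↦ Finset.sum_nonpos fun c _ ↦ ?_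
    exact traceCLM_comp_self_nonpos e he fun v w ↦ hGt.apply_covRiemAt_swap hx (e k) (e a) (e c) w v
  -- (3) the quadratic terms: `Vt = 2 Lt + 2 W` with `W` the cubic expression
  set W := ∑ a, ∑ c, ∑ i,
      (quadRiemAt (G t) e x (e a) (e c) (riemAt (G t) x (e a) (e c) (e i)) (e i)
        - quadRiemAt (G t) e x (e c) (e a) (riemAt (G t) x (e a) (e c) (e i)) (e i)
        + ricAt (G t) x (riemAt (G t) x (e a) (e c) (riemAt (G t) x (e a) (e c) (e i))) (e i)
        + ricAt (G t) x (riemAt (G t) x (e a) (e c) (e i)) (riemAt (G t) x (e a) (e c) (e i))) with hW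
  have hVt' : Vt = 2 * Lt + 2 * W := by
    simp only [hVt, hLt, hW]
    rw [sum_ginv_ginv_collapse e he hi, sum_ginv_ginv_collapse e he hi, Finset.mul_sum, Finset.mul_sum,
      ← Finset.sum_add_distrib]
    refine Finset.sum_congr rfl fun a _ ↦ ?_
    rw [Finset.mul_sum, Finset.mul_sum, ← Finset.sum_add_distrib]
    refine Finset.sum_congr rfl fun c _ ↦ ?_
    rw [traceCLM_comp_comm (riemAt (G t) x (e a) (e c)) (varRiemAt G S t x (e a) (e c)),
      hG.traceCLM_varRiemAt_comp e hfl hx ht, sum_ginv_collapse e he hi]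
    ring
  -- (4) `|J1| ≤ 4 n⁶ K³`
  have hTb : ∀ a a' c c', |traceCLM E ((riemAt (G t) x (e a) (e c)).comp (riemAt (G t) x (e a') (e c')))|
      ≤ n * (n * (K * K)) := fun a a' c c' ↦ abs_traceCLM_comp_le e he (hRK a c) (hRK a' c')
  have hJ1 : |J1| ≤ 4 * n ^ 6 * K ^ 3 := by
    have hsplit : J1 = ∑ a, ∑ a', ∑ c, 2 * ricAt (G t) x (e a) (e a') *
          traceCLM E ((riemAt (G t) x (e a) (e c)).comp (riemAt (G t) x (e a') (e c)))
        + ∑ a, ∑ c, ∑ c', 2 * ricAt (G t) x (e c) (e c') *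
          traceCLM E ((riemAt (G t) x (e a) (e c)).comp (riemAt (G t) x (e a) (e c'))) := by
      simp only [hJ1, add_mul, Finset.sum_add_distrib]
      congr 1
      · refine Finset.sum_congr rfl fun a _ ↦ Finset.sum_congr rfl fun a' _ ↦
          Finset.sum_congr rfl fun c _ ↦ ?_
        rw [← sum_ginv_mul_of_orthonormal e he hi (fun c' ↦ 2 * ricAt (G t) x (e a) (e a') *
          traceCLM E ((riemAt (G t) x (e a) (e c)).comp (riemAt (G t) x (e a') (e c')))) c]
        exact Finset.sum_congr rfl fun c' _ ↦ by ring
      · refine Finset.sum_congr rfl fun a _ ↦ ?_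
        rw [← sum_ginv_mul_of_orthonormal e he hi (fun a' ↦ ∑ c, ∑ c', 2 * ricAt (G t) x (e c) (e c') *
          traceCLM E ((riemAt (G t) x (e a) (e c)).comp (riemAt (G t) x (e a') (e c')))) a]
        refine Finset.sum_congr rfl fun a' _ ↦ ?_
        rw [Finset.mul_sum]
        refine Finset.sum_congr rfl fun c _ ↦ ?_
        rw [Finset.mul_sum]
        exact Finset.sum_congr rfl fun c' _ ↦ by ring
    have hterm : ∀ a a' c c' d d', |2 * ricAt (G t) x (e d) (e d') *
        traceCLM E ((riemAt (G t) x (e a) (e c)).comp (riemAt (G t) x (e a') (e c')))|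
        ≤ 2 * (n * K) * (n * (n * (K * K))) := by
      intro a a' c c' d d'
      rw [abs_mul, abs_mul, abs_two]
      exact mul_le_mul (mul_le_mul_of_nonneg_left (hRic d d') (by norm_num)) (hTb a a' c c')
        (abs_nonneg _) (by positivity)
    rw [hsplit]
    refine (abs_add_le _ _).trans ?_
    have hA : |∑ a, ∑ a', ∑ c, 2 * ricAt (G t) x (e a) (e a') *
        traceCLM E ((riemAt (G t) x (e a) (e c)).comp (riemAt (G t) x (e a') (e c)))|
        ≤ n ^ 3 * (2 * (n * K) * (n * (n * (K * K)))) := by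
      refine (Finset.abs_sum_le_sum_abs _ _).trans ?_
      calc ∑ a, |∑ a', ∑ c, 2 * ricAt (G t) x (e a) (e a') *
            traceCLM E ((riemAt (G t) x (e a) (e c)).comp (riemAt (G t) x (e a') (e c)))|
          ≤ ∑ _a : Fin (finrank ℝ E), ∑ _a' : Fin (finrank ℝ E), ∑ _c : Fin (finrank ℝ E),
              2 * (n * K) * (n * (n * (K * K))) :=
            Finset.sum_le_sum fun a _ ↦ (Finset.abs_sum_le_sum_abs _ _).trans
              (Finset.sum_le_sum fun a' _ ↦ (Finset.abs_sum_le_sum_abs _ _).trans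
                (Finset.sum_le_sum fun c _ ↦ hterm a a' c c a a'))
        _ = n ^ 3 * (2 * (n * K) * (n * (n * (K * K)))) := by
            simp only [Finset.sum_const, Finset.card_univ, nsmul_eq_mul, hn]; ring
    have hB : |∑ a, ∑ c, ∑ c', 2 * ricAt (G t) x (e c) (e c') *
        traceCLM E ((riemAt (G t) x (e a) (e c)).comp (riemAt (G t) x (e a) (e c')))|
        ≤ n ^ 3 * (2 * (n * K) * (n * (n * (K * K)))) := by
      refine (Finset.abs_sum_le_sum_abs _ _).trans ?_
      calc ∑ a, |∑ c, ∑ c', 2 * ricAt (G t) x (e c) (e c') *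
            traceCLM E ((riemAt (G t) x (e a) (e c)).comp (riemAt (G t) x (e a) (e c')))|
          ≤ ∑ _a : Fin (finrank ℝ E), ∑ _c : Fin (finrank ℝ E), ∑ _c' : Fin (finrank ℝ E),
              2 * (n * K) * (n * (n * (K * K))) :=
            Finset.sum_le_sum fun a _ ↦ (Finset.abs_sum_le_sum_abs _ _).trans
              (Finset.sum_le_sum fun c _ ↦ (Finset.abs_sum_le_sum_abs _ _).trans
                (Finset.sum_le_sum fun c' _ ↦ hterm a a c c' c c'))
        _ = n ^ 3 * (2 * (n * K) * (n * (n * (K * K)))) := by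
            simp only [Finset.sum_const, Finset.card_univ, nsmul_eq_mul, hn]; ring
    calc _ ≤ n ^ 3 * (2 * (n * K) * (n * (n * (K * K)))) + n ^ 3 * (2 * (n * K) * (n * (n * (K * K)))) :=
          add_le_add hA hB
      _ = 4 * n ^ 6 * K ^ 3 := by ring
  -- (5) `|W| ≤ (9 n⁶ + n⁷) K³`
  have hW' : |W| ≤ (9 * n ^ 6 + n ^ 7) * K ^ 3 := by
    have hRR : ∀ a c i p, |G t x (riemAt (G t) x (e a) (e c) (riemAt (G t) x (e a) (e c) (e i))) (e p)|
        ≤ n * (K * K) := fun a c i p ↦ abs_apply_comp_le e he (hRK a c) (hRK a c) i p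
    -- the endomorphisms `Q_k`
    have hQ : ∀ a c k i j, |G t x (((riemAt (G t) x (e k) (e a)).comp (riemAt (G t) x (e c) (e k))
        - (riemAt (G t) x (e c) (e k)).comp (riemAt (G t) x (e k) (e a))
        - riemAt (G t) x (riemAt (G t) x (e k) (e a) (e c)) (e k)
        - riemAt (G t) x (e c) (riemAt (G t) x (e k) (e a) (e k))) (e i)) (e j)| ≤ 4 * (n * (K * K)) := by
      intro a c k i j
      have b1 : |G t x ((riemAt (G t) x (e k) (e a)).comp (riemAt (G t) x (e c) (e k)) (e i)) (e j)|
          ≤ n * (K * K) := by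
        rw [ContinuousLinearMap.comp_apply]; exact abs_apply_comp_le e he (hRK k a) (hRK c k) i j
      have b2 : |G t x ((riemAt (G t) x (e c) (e k)).comp (riemAt (G t) x (e k) (e a)) (e i)) (e j)|
          ≤ n * (K * K) := by
        rw [ContinuousLinearMap.comp_apply]; exact abs_apply_comp_le e he (hRK c k) (hRK k a) i j
      have b3 : |G t x (riemAt (G t) x (riemAt (G t) x (e k) (e a) (e c)) (e k) (e i)) (e j)| ≤ n * (K * K) := by
        have h := abs_apply_riem_left_le e he (R := riemCLM (G t) x) hRK' (hRK k a c) k i j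
        simpa only [riemCLM_apply] using h
      have b4 : |G t x (riemAt (G t) x (e c) (riemAt (G t) x (e k) (e a) (e k)) (e i)) (e j)| ≤ n * (K * K) := by
        have h := abs_apply_riem_right_le e he (R := riemCLM (G t) x) hRK' (hRK k a k) c i j
        simpa only [riemCLM_apply] using h
      simp only [_root_.sub_apply, map_sub]
      have e1 := abs_sub (G t x ((riemAt (G t) x (e k) (e a)).comp (riemAt (G t) x (e c) (e k)) (e i)) (e j)
        - G t x ((riemAt (G t) x (e c) (e k)).comp (riemAt (G t) x (e k) (e a)) (e i)) (e j)
        - G t x (riemAt (G t) x (riemAt (G t) x (e k) (e a) (e c)) (e k) (e i)) (e j))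
        (G t x (riemAt (G t) x (e c) (riemAt (G t) x (e k) (e a) (e k)) (e i)) (e j))
      have e2 := abs_sub (G t x ((riemAt (G t) x (e k) (e a)).comp (riemAt (G t) x (e c) (e k)) (e i)) (e j)
        - G t x ((riemAt (G t) x (e c) (e k)).comp (riemAt (G t) x (e k) (e a)) (e i)) (e j))
        (G t x (riemAt (G t) x (riemAt (G t) x (e k) (e a) (e c)) (e k) (e i)) (e j))
      have e3 := abs_sub (G t x ((riemAt (G t) x (e k) (e a)).comp (riemAt (G t) x (e c) (e k)) (e i)) (e j))
        (G t x ((riemAt (G t) x (e c) (e k)).comp (riemAt (G t) x (e k) (e a)) (e i)) (e j))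
      linarith
    -- the quadratic terms
    have hquad : ∀ a c d d' i, |quadRiemAt (G t) e x (e d) (e d') (riemAt (G t) x (e a) (e c) (e i)) (e i)|
        ≤ n * (n * (K * (4 * (n * (K * K))))) := by
      intro a c d d' i
      rw [quadRiemAt_of_orthonormal e he hi]
      refine (Finset.abs_sum_le_sum_abs _ _).trans ?_
      calc ∑ k, |G t x (((riemAt (G t) x (e k) (e d)).comp (riemAt (G t) x (e d') (e k))
            - (riemAt (G t) x (e d') (e k)).comp (riemAt (G t) x (e k) (e d))
            - riemAt (G t) x (riemAt (G t) x (e k) (e d) (e d')) (e k)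
            - riemAt (G t) x (e d') (riemAt (G t) x (e k) (e d) (e k))) (riemAt (G t) x (e a) (e c) (e i))) (e i)|
          ≤ ∑ _k : Fin (finrank ℝ E), n * (K * (4 * (n * (K * K)))) :=
            Finset.sum_le_sum fun k _ ↦ abs_apply_vec_le e he (hQ d d' k) (hRK a c i) i
        _ = n * (n * (K * (4 * (n * (K * K))))) := by
            simp only [Finset.sum_const, Finset.card_univ, nsmul_eq_mul, hn]
    -- the Ricci terms
    have hric1 : ∀ a c i, |ricAt (G t) x (riemAt (G t) x (e a) (e c) (riemAt (G t) x (e a) (e c) (e i))) (e i)|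
        ≤ n * (n * ((n * (K * K)) * (1 * (n * K)))) :=
      fun a c i ↦ abs_bilin_le e he (β := ricAt (G t) x) hRic (hRR a c i) (h1 i)
    have hric2 : ∀ a c i, |ricAt (G t) x (riemAt (G t) x (e a) (e c) (e i)) (riemAt (G t) x (e a) (e c) (e i))|
        ≤ n * (n * (K * (K * (n * K)))) :=
      fun a c i ↦ abs_bilin_le e he (β := ricAt (G t) x) hRic (hRK a c i) (hRK a c i)
    have hterm : ∀ a c i, |quadRiemAt (G t) e x (e a) (e c) (riemAt (G t) x (e a) (e c) (e i)) (e i)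
        - quadRiemAt (G t) e x (e c) (e a) (riemAt (G t) x (e a) (e c) (e i)) (e i)
        + ricAt (G t) x (riemAt (G t) x (e a) (e c) (riemAt (G t) x (e a) (e c) (e i))) (e i)
        + ricAt (G t) x (riemAt (G t) x (e a) (e c) (e i)) (riemAt (G t) x (e a) (e c) (e i))|
        ≤ (9 * n ^ 3 + n ^ 4) * K ^ 3 := by
      intro a c i
      have q1 := hquad a c a c i
      have q2 := hquad a c c a i
      have r1 := hric1 a c i
      have r2 := hric2 a c i
      have e1 := abs_add_le (quadRiemAt (G t) e x (e a) (e c) (riemAt (G t) x (e a) (e c) (e i)) (e i)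
        - quadRiemAt (G t) e x (e c) (e a) (riemAt (G t) x (e a) (e c) (e i)) (e i)
        + ricAt (G t) x (riemAt (G t) x (e a) (e c) (riemAt (G t) x (e a) (e c) (e i))) (e i))
        (ricAt (G t) x (riemAt (G t) x (e a) (e c) (e i)) (riemAt (G t) x (e a) (e c) (e i)))
      have e2 := abs_add_le (quadRiemAt (G t) e x (e a) (e c) (riemAt (G t) x (e a) (e c) (e i)) (e i)
        - quadRiemAt (G t) e x (e c) (e a) (riemAt (G t) x (e a) (e c) (e i)) (e i))
        (ricAt (G t) x (riemAt (G t) x (e a) (e c) (riemAt (G t) x (e a) (e c) (e i))) (e i))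
      have e3 := abs_sub (quadRiemAt (G t) e x (e a) (e c) (riemAt (G t) x (e a) (e c) (e i)) (e i))
        (quadRiemAt (G t) e x (e c) (e a) (riemAt (G t) x (e a) (e c) (e i)) (e i))
      have hpoly : n * (n * (K * (4 * (n * (K * K))))) + n * (n * (K * (4 * (n * (K * K)))))
          + n * (n * ((n * (K * K)) * (1 * (n * K)))) + n * (n * (K * (K * (n * K))))
          = (9 * n ^ 3 + n ^ 4) * K ^ 3 := by ring
      linarith
    simp only [hW]
    refine (Finset.abs_sum_le_sum_abs _ _).trans ?_
    calc ∑ a, |∑ c, ∑ i, (quadRiemAt (G t) e x (e a) (e c) (riemAt (G t) x (e a) (e c) (e i)) (e i)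
          - quadRiemAt (G t) e x (e c) (e a) (riemAt (G t) x (e a) (e c) (e i)) (e i)
          + ricAt (G t) x (riemAt (G t) x (e a) (e c) (riemAt (G t) x (e a) (e c) (e i))) (e i)
          + ricAt (G t) x (riemAt (G t) x (e a) (e c) (e i)) (riemAt (G t) x (e a) (e c) (e i)))|
        ≤ ∑ _a : Fin (finrank ℝ E), ∑ _c : Fin (finrank ℝ E), ∑ _i : Fin (finrank ℝ E),
            (9 * n ^ 3 + n ^ 4) * K ^ 3 :=
          Finset.sum_le_sum fun a _ ↦ (Finset.abs_sum_le_sum_abs _ _).trans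
            (Finset.sum_le_sum fun c _ ↦ (Finset.abs_sum_le_sum_abs _ _).trans
              (Finset.sum_le_sum fun i _ ↦ hterm a c i))
      _ = (9 * n ^ 6 + n ^ 7) * K ^ 3 := by
          simp only [Finset.sum_const, Finset.card_univ, nsmul_eq_mul, hn]; ring
  -- (6) conclude
  rw [hVt']
  have hC : rmEvolutionConst (finrank ℝ E) * (u * K) = (22 * n ^ 6 + 2 * n ^ 7) * K ^ 3 := by
    rw [rmEvolutionConst, hK3, hn, hncard]
  rw [hC]
  have hJ1' := neg_abs_le J1
  have hW'' := neg_abs_le W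
  nlinarith [hJ1, hW', hN, hJ1', hW'', abs_nonneg J1, abs_nonneg W]

end Inequality

end IsMetricFamilyOn

end MetricCoord

end Literature.Geometry.Lorentzian

end
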